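import Summits.BirchSwinnertonDyer.BirchSwinnertonDyer.Theorems.ThetaPartnerAtTwoSignedKatoUpToAtTwoCoreOfPrimitiveCharValues
import Summits.BirchSwinnertonDyer.BirchSwinnertonDyer.Theorems.ByReductionTypeAtTwoSupersingularFlatMazurTateThreeTerm
import HarnessLib

/-!
# Crux `SupersingularRankZeroAtTwo` (K4, item stmt-BirchSwinnertonDyer-19097), line `odd_blind_package` v2.19, `stub_flatPackage`
# conjunct (8), F3 (the ♭ explicit reciprocity computation at `2`) — FILE E2b: the `a_p`-GENERIC LEVEL DESCENT (P-side + induction)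
# («primitive characters suffice» when `a_p ≠ 0`: both sides of the per-character identity obey the SAME three-term recursion)

Seat `bsd-2adic-tower-1` GEN 69, hand «hF3-ERL» (pen GEN 41 SUMMON 20260831T215831Z, director-bsd (979) slot 2). HONEST FRAMING:
theorems only (no definition, no named fact, no instance, no `sorry`); algebra of Mazur–Tate elements and of orbit sums of points in a
cyclotomic tower; helper toward conjunct (8) F3 of `stub_flatPackage`; closes no stub and no item; 19097 OPEN; BSD₂ is proved for no
supersingular curve and BSD for no curve by any of this.

## What

K3's «primitive characters suffice» (`SignedKatoOffTwo.CoreChi.coreChi_of_coreChiPrim`, line `colemanrat`) is the case `a_p = 0` of the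
three-term relations; the ♭ road at `a₂ ∈ {0, ±2}` needs them with the middle term:

* §1 (P-side, any `p`, any base, any functional on a subgroup `A` containing the three orbits) `sum_evalOn_pow_smul_add_two_eq_of_trace`:
  for `ζ^{p^{n+1}} = 1` and the Honda trace relation `Tr_{n+2/n+1} d_{n+2} = a•d_{n+1} − d_n`,
  `∑_{j<p^{n+2}} φ(z(gʲ d_{n+2})) ζʲ = a · ∑_{j<p^{n+1}} φ(z(gʲ d_{n+1})) ζʲ − (∑_{i<p} ζ^{pⁿ i}) · ∑_{j<pⁿ} φ(z(gʲ d_n)) ζʲ`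
  (K3's `CoreChi.sum_evalOn_pow_smul_add_two_eq_of_mem` is `a = 0`).
* (θ-side: the sibling file `…FlatMazurTateThreeTerm` — `SSFlatERL.cyclotomicOmega_dvd_mazurTateElement_sub_add`,
  `ω_{n+1} ∣ θ_{n+2} − C a · θ_{n+1} + Φ_{p^{n+1}}(1+T) · θ_n`, and `eval₂_mazurTateElement_add_two_eq_of_cuspCoeff`.)
* §2 (`p = 2`) `forall_char_of_primitive_or_le_one`: for `μ ν : Λ` and the values `V n j ∈ ℤ₂` of a functional on the orbits `gʲ d_n`
  obeying the `a`-recursion of §1, if «`ν(χ(5)−1) · ∑_{j<2ⁿ} V n j χ(5)ʲ = μ(χ(5)−1) · ratTwistedSymbolSum f χ`» holds for every even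
  `2`-power-order `χ` modulo `2^{n+2}` that is PRIMITIVE or has `n ≤ 1`, then it holds for every such `χ` — strong induction on `n` exactly as
  in K3, descending an imprimitive `χ` of level `m+2` (`χ(5)^{2^{m+1}} = 1`) to levels `m+1` and `m` by §1/§2.

References: [MazurTateTeitelbaum1986Invent] §I.4 (4.2), §I.10 Prop. (10.2), §I.13; [Kobayashi2003] Def. 1.1, §8.4, proof of Thm. 6.3
(p. 25); [Sprung2012] F. Sprung, J. Number Theory 132 (2012), Thm. 2.2, Def. 3.1, Props. 6.3–6.5; [Washington1997] §7.2.
-/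

set_option autoImplicit false
-- the Theorems namespace of this sub repeats the summit name by design (D-0017 nested layout)
set_option linter.dupNamespace false

noncomputable section

open scoped Classical MatrixGroups ModularForm NumberField

open CongruenceSubgroup WeierstrassCurve Field IsDedekindDomain NumberField Polynomial
  Literature.NumberTheory.GaloisRepresentations
  Literature.NumberTheory.EllipticCurves Literature.NumberTheory.EllipticCurves.ModularForms
  Literature.NumberTheory.EllipticCurves.Kobayashi2003 Literature.NumberTheory.EllipticCurves.Sprung2012
  ZpExtension
  Summit.BirchSwinnertonDyer.BirchSwinnertonDyer.Theorems.SignedKatoOffTwo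
  Summit.BirchSwinnertonDyer.BirchSwinnertonDyer.Theorems.SignedKatoOffTwo.CoreChi

namespace Summit.BirchSwinnertonDyer.BirchSwinnertonDyer.Theorems.SSFlatERL

/-! ## §1 The P-side: `∑_{j<p^{n+2}} z(gʲ d_{n+2}) ζʲ = a·∑_{j<p^{n+1}} z(gʲ d_{n+1}) ζʲ − Φ_{p^{n+1}}(ζ)·∑_{j<pⁿ} z(gʲ d_n) ζʲ` -/

section Orbit

universe u

variable {K : Type u} [Field K] {p : ℕ} [hp : Fact p.Prime] (κ : ZpExtension K p)
  {E : Type u} [Field E] [Algebra K E] (ι : AlgebraicClosure K →ₐ[K] AlgebraicClosure E)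
  (W : WeierstrassCurve K)

/-- `Sprung2012.evalOn` at `P − P'`, `P, P' ∈ A`. [folklore] -/
theorem evalOn_sub_of_mem {R : Type*} [CommRing R] (A : AddSubgroup (localPoints W E)) (z : A →+ ℤ_[p])
    (φ : ℤ_[p] →+* R) {P P' : localPoints W E} (hP : P ∈ A) (hP' : P' ∈ A) :
    φ (evalOn W A z (P - P')) = φ (evalOn W A z P) - φ (evalOn W A z P') := by
  rw [evalOn_of_mem W A z (sub_mem hP hP'), evalOn_of_mem W A z hP, evalOn_of_mem W A z hP', ← map_sub, ← map_sub]
  rfl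

/-- `Sprung2012.evalOn` at `a • P`, `P ∈ A`, `a ∈ ℤ`. [folklore] -/
theorem evalOn_zsmul_of_mem {R : Type*} [CommRing R] (A : AddSubgroup (localPoints W E)) (z : A →+ ℤ_[p])
    (φ : ℤ_[p] →+* R) (a : ℤ) {P : localPoints W E} (hP : P ∈ A) :
    φ (evalOn W A z (a • P)) = (a : R) * φ (evalOn W A z P) := by
  rw [evalOn_of_mem W A z (AddSubgroup.zsmul_mem A hP a), evalOn_of_mem W A z hP, ← map_intCast φ a, ← map_mul,
    ← zsmul_eq_mul, ← map_zsmul]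
  rfl

/-- **The P-side three-term relation for a general `a_p`.** Let `g ∈ Γ_E` restrict to the topological generator of `Γ = Gal(K_∞/K)`,
`d : ℕ → E(K̄_E)` with `d_m ∈ E(K_m·E)` and the Honda trace relation `Tr_{n+2/n+1} d_{n+2} = a•d_{n+1} − d_n`, `A` an additive subgroup
containing the `g`-orbits of `d_{n+2}, d_{n+1}, d_n`, `z : A →+ ℤ_p`, `φ` a ring map to a commutative ring containing `ζ` with `ζ^{p^{n+1}} = 1`.
Then `∑_{j<p^{n+2}} φ(z(gʲ d_{n+2})) ζʲ = a·∑_{j<p^{n+1}} φ(z(gʲ d_{n+1})) ζʲ − (∑_{i<p} ζ^{pⁿ i})·∑_{j<pⁿ} φ(z(gʲ d_n)) ζʲ`: group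
`j = i + p^{n+1}k` (`ζ^j = ζ^i`, `∑_k g^{p^{n+1}k} = Tr_{n+2/n+1}`, `localTraceOfEmb_succ_eq_sum_pow_smul`), use the trace relation, and for the
`d_n`-term group `i = j + pⁿ k` (`g^{pⁿ k} d_n = d_n`). The case `a = 0` is K3's `CoreChi.sum_evalOn_pow_smul_add_two_eq_of_mem`.
[cite: Kobayashi2003, Def. 1.1, Thm. 6.3 (proof, p. 25)] [cite: Sprung2012, Thm. 2.2 (p. 1487), Def. 3.1 (p. 1489)] -/
theorem sum_evalOn_pow_smul_add_two_eq_of_trace {R : Type*} [CommRing R] (φ : ℤ_[p] →+* R) {g : Field.absoluteGaloisGroup E}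
    (hg : κ.IsTopGenerator (resGalOfEmb ι g)) {d : ℕ → localPoints W E}
    (hL : ∀ m, d m ∈ localLayerPointsOfEmb κ ι W m) (a : ℤ) (n : ℕ)
    (hTR : localTraceOfEmb κ ι W (n + 1) (n + 2) (d (n + 2)) = a • d (n + 1) - d n)
    (A : AddSubgroup (localPoints W E)) (hA2 : ∀ j : ℕ, g ^ j • d (n + 2) ∈ A) (hA1 : ∀ j : ℕ, g ^ j • d (n + 1) ∈ A)
    (hA0 : ∀ j : ℕ, g ^ j • d n ∈ A) (z : A →+ ℤ_[p]) {ζ : R} (hζ : ζ ^ p ^ (n + 1) = 1) :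
    ∑ j ∈ Finset.range (p ^ (n + 2)), φ (evalOn W A z (g ^ j • d (n + 2))) * ζ ^ j =
      (a : R) * ∑ j ∈ Finset.range (p ^ (n + 1)), φ (evalOn W A z (g ^ j • d (n + 1))) * ζ ^ j -
        (∑ i ∈ Finset.range p, ζ ^ (p ^ n * i)) *
          ∑ j ∈ Finset.range (p ^ n), φ (evalOn W A z (g ^ j • d n)) * ζ ^ j := by
  have hζpow : ∀ i k : ℕ, ζ ^ (i + p ^ (n + 1) * k) = ζ ^ i := fun i k ↦ by
    rw [pow_add, pow_mul, hζ, one_pow, mul_one]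
  -- Step 1: group `j = i + p^{n+1} k` and use the trace relation
  have h1 : ∑ j ∈ Finset.range (p ^ (n + 2)), φ (evalOn W A z (g ^ j • d (n + 2))) * ζ ^ j =
      ∑ i ∈ Finset.range (p ^ (n + 1)),
        ((a : R) * φ (evalOn W A z (g ^ i • d (n + 1))) - φ (evalOn W A z (g ^ i • d n))) * ζ ^ i := by
    rw [pow_succ, sum_range_mul_eq_sum_sum, Finset.sum_comm]
    refine Finset.sum_congr rfl fun i _ ↦ ?_
    have hsplit : ∀ k : ℕ, g ^ (i + p ^ (n + 1) * k) • d (n + 2) = g ^ i • (g ^ (p ^ (n + 1) * k) • d (n + 2)) := fun k ↦ by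
      rw [pow_add, mul_smul]
    simp_rw [hζpow, hsplit]
    rw [← Finset.sum_mul]
    congr 1
    have hmem : ∀ k ∈ Finset.range p, g ^ i • (g ^ (p ^ (n + 1) * k) • d (n + 2)) ∈ A := fun k _ ↦ by
      rw [← mul_smul, ← pow_add]; exact hA2 _
    rw [← evalOn_sum_of_mem W A z φ _ _ hmem, ← Finset.smul_sum,
      ← localTraceOfEmb_succ_eq_sum_pow_smul κ ι W hg (n + 1) (hL (n + 2)), hTR, smul_sub, smul_comm,
      evalOn_sub_of_mem W A z φ (AddSubgroup.zsmul_mem A (hA1 i) a) (hA0 i), evalOn_zsmul_of_mem W A z φ a (hA1 i)]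
  -- Step 2: split, and for the `d_n`-term group `i = j + pⁿ k`
  have h2 : ∑ i ∈ Finset.range (p ^ (n + 1)), φ (evalOn W A z (g ^ i • d n)) * ζ ^ i =
      (∑ k ∈ Finset.range p, ζ ^ (p ^ n * k)) * ∑ j ∈ Finset.range (p ^ n), φ (evalOn W A z (g ^ j • d n)) * ζ ^ j := by
    rw [pow_succ, sum_range_mul_eq_sum_sum, Finset.sum_mul]
    refine Finset.sum_congr rfl fun k _ ↦ ?_
    rw [Finset.mul_sum]
    refine Finset.sum_congr rfl fun j _ ↦ ?_
    rw [pow_add, mul_smul, pow_mul_smul_of_mem_localLayerPointsOfEmb κ ι W hg (hL n) k, pow_add]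
    ring
  rw [h1, ← h2, Finset.mul_sum, ← Finset.sum_sub_distrib]
  refine Finset.sum_congr rfl fun i _ ↦ ?_
  ring

end Orbit

/-! ## §2 «Primitive characters suffice» at `p = 2` for a general `a₂` -/

section Induction

variable {N : ℕ} [NeZero N] {f : CuspForm (Gamma0 N) 2}

/-- **Primitive characters (and the levels `n ≤ 1`) suffice, `a₂`-generic.** Let `f` be a rational newform of odd level with `a₂(f) = a`,
`μ ν ∈ Λ = ℤ₂⟦T⟧`, and `V : ℕ → ℕ → ℤ₂` values obeying the P-side recursion of §1 read in `ℂ₂`: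
`∑_{j<2^{n+2}} V (n+2) j ζʲ = a·∑_{j<2^{n+1}} V (n+1) j ζʲ − (∑_{i<2} ζ^{2ⁿ i})·∑_{j<2ⁿ} V n j ζʲ` whenever `ζ^{2^{n+1}} = 1`. If for every `n`
and every even `2`-power-order Dirichlet character `χ` modulo `2^{n+2}` that is PRIMITIVE or has `n ≤ 1`
`ν(χ(5)−1) · ∑_{j<2ⁿ} V n j χ(5)ʲ = μ(χ(5)−1) · ratTwistedSymbolSum f χ` (`x(z) = ∑ ι(x_k) zᵏ`), then the same identity holds for EVERY
such `χ`: strong induction on `n`; an imprimitive `χ` at level `m+2` has `χ(5)^{2^{m+1}} = 1`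
(`CoreChi.apply_cyclotomicGenerator_pow_eq_one_of_not_isPrimitive`); both sides then obey the three-term recursion (hypothesis /
`eval₂_mazurTateElement_add_two_eq_of_cuspCoeff` + Birch `eval₂_mazurTateElement_eq_ratTwistedSymbolSum`); level `m+1` is the induction
hypothesis at a character `χ'` of `G_{m+1}` with `χ'(5) = χ(5)` (`CoreChi.exists_even_char_apply_cyclotomicGenerator_eq`), and level `m`
likewise when `χ(5)^{2^m} = 1`, while for `χ(5)^{2^m} = −1` the factor `1 + χ(5)^{2^m}` vanishes. (K3's `CoreChi.coreChi_of_coreChiPrim`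
is the case `a = 0`.) [cite: Kobayashi2003, Thm. 6.3 (proof, p. 25)] [cite: MazurTateTeitelbaum1986Invent, §I.10 Prop. (10.2)]
[cite: Sprung2012, Props. 6.3–6.5] -/
theorem forall_char_of_primitive_or_le_one (hf0 : IsNewform0 f) (hQ : coeffField f = ⊥) (h2N : ¬ 2 ∣ N)
    {a : ℤ} (hap : cuspCoeff f 2 = (a : ℂ)) (μ ν : IwasawaAlgebra 2) (V : ℕ → ℕ → ℤ_[2])
    (hV : ∀ (n : ℕ) (ζ : ℂ_[2]), ζ ^ 2 ^ (n + 1) = 1 →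
      ∑ j ∈ Finset.range (2 ^ (n + 2)), ((algebraMap ℚ_[2] ℂ_[2]).comp (algebraMap ℤ_[2] ℚ_[2])) (V (n + 2) j) * ζ ^ j =
        (a : ℂ_[2]) * ∑ j ∈ Finset.range (2 ^ (n + 1)), ((algebraMap ℚ_[2] ℂ_[2]).comp (algebraMap ℤ_[2] ℚ_[2])) (V (n + 1) j) * ζ ^ j -
          (∑ i ∈ Finset.range 2, ζ ^ (2 ^ n * i)) *
            ∑ j ∈ Finset.range (2 ^ n), ((algebraMap ℚ_[2] ℂ_[2]).comp (algebraMap ℤ_[2] ℚ_[2])) (V n j) * ζ ^ j)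
    (hprim : ∀ (n : ℕ) (χ : DirichletCharacter ℂ_[2] (2 ^ (n + cyclotomicExponent 2))),
      χ.Even → (∃ j : ℕ, orderOf χ = 2 ^ j) → (χ.IsPrimitive ∨ n ≤ 1) →
      (∑' k, ((algebraMap ℚ_[2] ℂ_[2]).comp (algebraMap ℤ_[2] ℚ_[2])) (PowerSeries.coeff k ν) *
          (χ (cyclotomicGenerator 2 : ZMod (2 ^ (n + cyclotomicExponent 2))) - 1) ^ k) *
        (∑ j ∈ Finset.range (2 ^ n), ((algebraMap ℚ_[2] ℂ_[2]).comp (algebraMap ℤ_[2] ℚ_[2])) (V n j) *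
          χ (cyclotomicGenerator 2 : ZMod (2 ^ (n + cyclotomicExponent 2))) ^ j) =
      (∑' k, ((algebraMap ℚ_[2] ℂ_[2]).comp (algebraMap ℤ_[2] ℚ_[2])) (PowerSeries.coeff k μ) *
          (χ (cyclotomicGenerator 2 : ZMod (2 ^ (n + cyclotomicExponent 2))) - 1) ^ k) *
        ratTwistedSymbolSum f χ)
    (n : ℕ) (χ : DirichletCharacter ℂ_[2] (2 ^ (n + cyclotomicExponent 2))) (hev : χ.Even)
    (hord : ∃ j : ℕ, orderOf χ = 2 ^ j) :
    (∑' k, ((algebraMap ℚ_[2] ℂ_[2]).comp (algebraMap ℤ_[2] ℚ_[2])) (PowerSeries.coeff k ν) *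
        (χ (cyclotomicGenerator 2 : ZMod (2 ^ (n + cyclotomicExponent 2))) - 1) ^ k) *
      (∑ j ∈ Finset.range (2 ^ n), ((algebraMap ℚ_[2] ℂ_[2]).comp (algebraMap ℤ_[2] ℚ_[2])) (V n j) *
        χ (cyclotomicGenerator 2 : ZMod (2 ^ (n + cyclotomicExponent 2))) ^ j) =
    (∑' k, ((algebraMap ℚ_[2] ℂ_[2]).comp (algebraMap ℤ_[2] ℚ_[2])) (PowerSeries.coeff k μ) *
        (χ (cyclotomicGenerator 2 : ZMod (2 ^ (n + cyclotomicExponent 2))) - 1) ^ k) *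
      ratTwistedSymbolSum f χ := by
  set ιZ : ℤ_[2] →+* ℂ_[2] := (algebraMap ℚ_[2] ℂ_[2]).comp (algebraMap ℤ_[2] ℚ_[2]) with hιZ
  induction n using Nat.strong_induction_on with
  | _ n ih =>
  by_cases hbase : χ.IsPrimitive ∨ n ≤ 1
  · exact hprim n χ hev hord hbase
  have hnp : ¬ χ.IsPrimitive := fun h ↦ hbase (Or.inl h)
  have hn : ¬ n ≤ 1 := fun h ↦ hbase (Or.inr h)
  obtain ⟨m, rfl⟩ : ∃ m, n = m + 2 := ⟨n - 2, by omega⟩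
  set ζ : ℂ_[2] := χ (cyclotomicGenerator 2 : ZMod (2 ^ (m + 2 + cyclotomicExponent 2))) with hζdef
  have hζ1 : ζ ^ 2 ^ (m + 1) = 1 := apply_cyclotomicGenerator_pow_eq_one_of_not_isPrimitive m χ hnp
  -- the two three-term relations and Birch at level `m + 2`
  have hP := hV m ζ hζ1
  have hθ := eval₂_mazurTateElement_add_two_eq_of_cuspCoeff (p := 2) hf0 hQ h2N hap m hζ1
  have hB := eval₂_mazurTateElement_eq_ratTwistedSymbolSum f χ hev hord
  rw [← hζdef] at hB
  -- level `m + 1`: a character `χ₁` of `G_{m+1}` with `χ₁(γ) = ζ`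
  obtain ⟨χ₁, hev₁, hord₁, hχ₁⟩ := exists_even_char_apply_cyclotomicGenerator_eq (m + 1) hζ1
  have hIH₁ := ih (m + 1) (by omega) χ₁ hev₁ hord₁
  have hB₁ := eval₂_mazurTateElement_eq_ratTwistedSymbolSum f χ₁ hev₁ hord₁
  rw [hχ₁] at hIH₁ hB₁
  rw [← hB₁] at hIH₁
  rw [hP, ← hB, hθ]
  by_cases hA : ζ ^ 2 ^ m = 1
  · -- descend also to a character of `G_m` with the same `χ(γ)`
    obtain ⟨χ', hev', hord', hχ'⟩ := exists_even_char_apply_cyclotomicGenerator_eq m hA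
    have hIH := ih m (by omega) χ' hev' hord'
    have hB' := eval₂_mazurTateElement_eq_ratTwistedSymbolSum f χ' hev' hord'
    rw [hχ'] at hIH hB'
    rw [← hB'] at hIH
    linear_combination (a : ℂ_[2]) * hIH₁ - (∑ i ∈ Finset.range 2, ζ ^ (2 ^ m * i)) * hIH
  · -- `ζ^{2^m} = -1`: the `Φ`-terms vanish
    have hsq : (ζ ^ 2 ^ m) ^ 2 = 1 := by rw [← pow_mul, ← pow_succ, hζ1]
    have hneg : ζ ^ 2 ^ m = -1 := (sq_eq_one_iff.mp hsq).resolve_left hA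
    have hS : ∑ i ∈ Finset.range 2, ζ ^ (2 ^ m * i) = 0 := by
      rw [Finset.sum_range_succ, Finset.sum_range_succ, Finset.sum_range_zero, zero_add, mul_zero, pow_zero, mul_one, hneg]
      ring
    rw [hS]
    linear_combination (a : ℂ_[2]) * hIH₁

end Induction

end Summit.BirchSwinnertonDyer.BirchSwinnertonDyer.Theorems.SSFlatERL

end
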